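import Literature.NumberTheory.EllipticCurves.FineSelmerLayerCriterionRat
import Literature.NumberTheory.NumberFields.EquivariantIwasawaLemmaInertia
import Literature.NumberTheory.EllipticCurves.DivisionField
import HarnessLib

/-!
# Statement (A) of Coates–Sujatha at `(E, p)` from the LAYER-0 ISOTYPIC INPUT and `−1 ∈ ρ̄(I(𝔮|p))` (image-agnostic door L6, inertia form)

Topic `NumberTheory/EllipticCurves` (grouping sub-namespace `CoatesSujatha2005.RankEqualityRoad`).  THEOREM-ONLY (no definition, no named fact, no
`sorry`); prover seat `bsd-potss-k8t-c4` g26 (cell `bsd-potss`, `--supports stmt-BirchSwinnertonDyer-19982`; closes nothing; neither BSD nor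
Conjecture A is booked for any curve).

`conjA_of_homTrivial_layerZero_of_neg_one_mem_inertia` — `E/ℚ`, `p` odd, `p ∤ #Gal(ℚ(E[p])/ℚ)`; an element `σ_m ∈ Γ_ℚ` acting as `−1` on `E[p]` whose
restriction lies in the inertia group `I(𝔮)` of EVERY prime `𝔮 ∋ p` of `ℚ(E[p])` (`hcI`; a kernel theorem for `C_ns⁺(5)` and `G₁₆` images —
`FineSelmerRankEqualityNonsplitCartanFiveInertia`, `…SplitCartanFiveIndexTwo` — and a displayed per-row ramification datum for the full `C_s⁺(5)` and for
Zywina's `G₉`); and the layer-0 isotypic input (c2*)₀ «every additive `Γ_ℚ`-equivariant `Cl(𝓞_{ℚ(E[p])}) → E[p]` is zero».  THEN the dual fine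
Selmer group of `E` over `ℚ_cyc` is finitely generated over `ℤ_p` for every cyclotomic `ℤ_p`-extension: door L6 in inertia form
(`EquivariantIwasawaLemma.equivariantHom_classGroup_eq_zero_layer_compositum_tower_of_inertia`, k8t-c4 g25; (c3*-I) because `−1` fixes no non-zero
vector and `p ≠ 2`) followed by door L5 (`conjA_of_homTrivial_layer_above_p`, conjA-anchor).  No frame `e`, no image hypothesis beyond `hG`; meant
for the `5Ns` / `5S4` rows where the rank-equality road is shut (then (c2*)₀ is the weaker, isotypic input).

## References

* L. C. Washington, *Introduction to Cyclotomic Fields*, GTM 83, §13.3 Lemmas 13.14–13.15, Thm. 10.4. [Washington1997]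
* J. Coates, R. Sujatha, Math. Ann. 331 (2005), §3 Thm. 3.4, Lemma 3.8. [CoatesSujatha2005]
* S. V. Deo, A. Ray, R. Sujatha, PAMQ 19 (2023), §3 Thm. 3.8. [DeoRaySujatha2023]
-/

set_option autoImplicit false

noncomputable section

open scoped Classical NumberField
open WeierstrassCurve Field IntermediateField
  Literature.NumberTheory.GaloisRepresentations Literature.NumberTheory.IwasawaTheory Literature.NumberTheory.NumberFields

namespace Literature.NumberTheory.EllipticCurves.CoatesSujatha2005

namespace RankEqualityRoad

/-- `p ∤ [L : k]` from `p ∤ #Gal(L/k)`. [folklore] -/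
private theorem not_dvd_finrank_of_not_dvd_cardₐ {k : Type} [Field k] (L : IntermediateField k (AlgebraicClosure k))
    [FiniteDimensional k L] [IsGalois k L] {p : ℕ} (h : ¬ p ∣ Nat.card (L ≃ₐ[k] L)) : ¬ p ∣ Module.finrank k L := by
  rwa [← IsGalois.card_aut_eq_finrank k L]

/-- In an abelian group where `p • v = 0` for an odd prime `p`, `−v = v` forces `v = 0`. [folklore] -/
private theorem eq_zero_of_neg_eq_of_prime_smulₐ {V : Type*} [AddCommGroup V] {p : ℕ} (hp : p.Prime) (hp2 : p ≠ 2)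
    {v : V} (hpv : p • v = 0) (h : -v = v) : v = 0 := by
  have h2 : (2 : ℕ) • v = 0 := by rw [two_nsmul]; nth_rw 1 [← h]; exact neg_add_cancel v
  have hcop : Nat.Coprime 2 p := (Nat.coprime_primes Nat.prime_two hp).mpr (Ne.symm hp2)
  obtain ⟨a, b, hab⟩ := Nat.isCoprime_iff_coprime.mpr hcop
  -- `v = (2a + pb) • v = a • (2 • v) + b • (p • v) = 0`
  have h1 : ((2 : ℤ) * a + (p : ℤ) * b) • v = v := by
    have : (2 : ℤ) * a + (p : ℤ) * b = 1 := by push_cast at hab; linarith [hab]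
    rw [this, one_zsmul]
  rw [← h1, add_zsmul, mul_comm (2 : ℤ) a, mul_comm (p : ℤ) b, mul_zsmul, mul_zsmul,
    show (2 : ℤ) • v = (2 : ℕ) • v from (natCast_zsmul v 2), show (p : ℤ) • v = (p : ℕ) • v from (natCast_zsmul v p),
    h2, hpv, zsmul_zero, zsmul_zero, add_zero]

set_option maxHeartbeats 1600000 in
set_option synthInstance.maxHeartbeats 400000 in
/-- **(A) at `(E, p)` from (c2*)₀ and `−1 ∈ ρ̄(I(𝔮|p))` — no frame, no `μ`-hypothesis, no named fact.**  `E/ℚ`, `p` odd with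
`p ∤ #Gal(ℚ(E[p])/ℚ)`, `σ_m ∈ Γ_ℚ` acting as `−1` on `E[p]` with `σ̄_m ∈ I(𝔮)` for every prime `𝔮 ∋ p` of `ℚ(E[p])`, and every additive
`Γ_ℚ`-equivariant `Cl(𝓞_{ℚ(E[p])}) → E[p]` zero.  Then the dual fine Selmer group of `E` over `ℚ_cyc` is finitely generated over `ℤ_p` for every
cyclotomic `ℤ_p`-extension (door L6, inertia form: `σ_m` fixes no non-zero vector, `p ≠ 2`; then door L5).
[cite: CoatesSujatha2005, §3 Thm. 3.4 and Lemma 3.8] [cite: DeoRaySujatha2023, §3 Thm. 3.8 (arXiv:2202.09937 p. 9)]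
[cite: Washington1997, §13.3 Lemmas 13.14–13.15 and Thm. 10.4] -/
theorem conjA_of_homTrivial_layerZero_of_neg_one_mem_inertia (W : WeierstrassCurve ℚ) [W.IsElliptic] {p : ℕ} [Fact p.Prime] (hp2 : p ≠ 2)
    (hG : ¬ p ∣ Nat.card (↥(W.divisionField p) ≃ₐ[ℚ] ↥(W.divisionField p)))
    (σm : absoluteGaloisGroup ℚ) (hσm : ∀ P : W.geomTorsion (p : ℕ), σm • P = -P)
    (hcI : ∀ (𝔮 : Ideal (𝓞 ↥(W.divisionField p))) [𝔮.IsMaximal], ((p : ℕ) : 𝓞 ↥(W.divisionField p)) ∈ 𝔮 →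
      absRestrictNormalHom (W.divisionField p) σm ∈ 𝔮.inertia _)
    (h0 : ∀ μ : Additive (ClassGroup (𝓞 ↥(W.divisionField p))) →+ W.geomTorsion (p : ℕ),
      (∀ (τ : absoluteGaloisGroup ℚ) (c : ClassGroup (𝓞 ↥(W.divisionField p))),
        μ (Additive.ofMul (ClassGroup.mulEquiv
          (AmbiguousClass.intAut (absRestrictNormalHom (W.divisionField p) τ)) c)) = τ • μ (Additive.ofMul c)) → μ = 0)
    (κ : ZpExtension ℚ p) (hκ : κ.IsCyclotomic) :
    ∃ (γ : absoluteGaloisGroup ℚ) (D : W.FineSelmerDualData κ γ),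
      Module.Finite ℤ_[p] (RestrictScalars ℤ_[p] (IwasawaAlgebra p) D.X) := by
  classical
  have hp : p.Prime := Fact.out
  haveI : NeZero p := ⟨hp.ne_zero⟩
  haveI := fun m => κ.isGalois_layer_holds m
  haveI := fun m => κ.finiteDimensional_layer_holds m
  haveI hNF : ∀ m, NumberField ↥(W.divisionField p ⊔ κ.layer m) := fun m => NumberField.of_module_finite ℚ _
  haveI : NumberField ↥(W.divisionField p) := NumberField.mk
  have hL₀ := not_dvd_finrank_of_not_dvd_cardₐ (W.divisionField p) hG
  have hram := EquivariantIwasawaLemma.exists_isMaximal_inertia_sup_kerSubgroup_eq_top_of_isCyclotomic hκ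
  have hpV : ∀ v : W.geomTorsion (p : ℕ), p • v = 0 := by
    intro v
    apply Subtype.ext
    have hv : ((v : W.geomTorsion (p : ℕ)) : geomPoints W) ∈ AddSubgroup.torsionBy (geomPoints W) ((p : ℕ) : ℤ) := v.2
    rw [AddSubgroup.torsionBy, Submodule.mem_toAddSubgroup, Submodule.mem_torsionBy_iff] at hv
    rw [AddSubgroupClass.coe_nsmul, ZeroMemClass.coe_zero, ← natCast_zsmul]
    exact hv
  have hV : ∀ τ : absoluteGaloisGroup ℚ, absRestrictNormalHom (W.divisionField p) τ = 1 →
      ∀ v : W.geomTorsion (p : ℕ), τ • v = v :=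
    fun τ hτ v => (W.absRestrictNormalHom_divisionField_eq_one_iff p τ).mp hτ v
  have hDI : ∀ (𝔮 : Ideal (𝓞 ↥(W.divisionField p))) [𝔮.IsMaximal], ((p : ℕ) : 𝓞 ↥(W.divisionField p)) ∈ 𝔮 →
      ∀ w : W.geomTorsion (p : ℕ), (∀ τ : absoluteGaloisGroup ℚ,
        absRestrictNormalHom (W.divisionField p) τ ∈ 𝔮.inertia (↥(W.divisionField p) ≃ₐ[ℚ] ↥(W.divisionField p)) →
          τ • w = w) → w = 0 := by
    intro 𝔮 _ h𝔮 w hw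
    have h1 := hw σm (hcI 𝔮 h𝔮)
    rw [hσm] at h1
    exact eq_zero_of_neg_eq_of_prime_smulₐ hp hp2 (hpV w) h1
  exact conjA_of_homTrivial_layer_above_p W hp2 hG hκ 0 (fun f hf _ =>
    EquivariantIwasawaLemma.equivariantHom_classGroup_eq_zero_layer_compositum_tower_of_inertia hp2 κ
      (W.divisionField p) hL₀ hram hpV hV h0 hDI (0 + 1) f hf)

end RankEqualityRoad

end Literature.NumberTheory.EllipticCurves.CoatesSujatha2005

end
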